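import Summits.KontsevichZagierPeriods.Zeta5Search.Barrier.ConeGammaLemmaFWinBoxCert
import Summits.KontsevichZagierPeriods.Zeta5Search.Barrier.ConeGammaLemmaFBoxBoxes

/-!
# ζ(5) search — BARRIER: `γ` AS ONE AFFINE FORM ON A BOX — the correlated box certificate (checker + soundness)

HONEST FRAMING (cell `pub-zeta5`): systematic search; no irrationality claim unless kernel-certified. Kernel ARITHMETIC
about the MODEL functionals `C₁`, `C₀`, `δ₂₈`, `Φ = phi30` and the MODEL rate `γ = gamma` of `ConeGammaRates` under
Brown–Zudilin's (28)+(30) ((28) observed, not proved) on a seven-coordinate direction BOX `lo_i ≤ D·t_i ≤ hi_i` (`t₀ = 1`,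
`t = s/s₀`; cert-2 g34/g36's boxes). Every `γ`-bound obtained this way is an UPPER bound over its box, ABOVE the centre's
pinned value; NOTHING here is about the cone's supremum (C2 = `BarrierC2`, OPEN), S-E (CONJECTURED), (TD_A) or `ζ(5)`;
no number of record moves; records in print UNMOVED. Theory seat cert-2 g39 (item «γ AS ONE AFFINE FORM ON A BOX — THE
CORRELATED CERTIFICATE», INBOX plan 2026-08-27; cert-2 g38's memo `FARPOINT-KERNEL.md` §4 (b)).

THE ARITHMETIC. cert-2 g37/g38 assemble `γ ≤ (c₁⁺ − c₀⁻)/(c₁⁺ + δ⁻ − β)` from the WORST CORNER of each piece separately.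
Here the four pieces are combined into ONE affine inequality on the box before any supremum is taken:
`(1 − γ*)·C₁ − C₀ − γ*·δ₂₈ + γ*·Φ ≤ 0` on the box `⇒ γ ≤ γ*` (given `C₀ ≤ C₁`), with
* `C₁ ≤ s₀·c₁⁺/den`, `s₀·c₀⁻/den ≤ C₀` — HYPOTHESES of the theorem (discharged per box by g38's `C1_le_farBox_…`,
  `C0_mem_farBox_…`, by name);
* `δ₂₈(aOfS t) ≥ (1/W)·Σ_{j<W} Σ_{k∈S_j} h_k(aOfS t)` for ANY list of `W` five-element index sets (`le_delta28`; the
  convex PL `δ₂₈` lies above every convex combination of its linear pieces — an EXACT linear minorant, `delta28_ge_mixture`);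
* `Φ(a) ≤ s₀·(I.hi/SC + Σ_i (t_i − t_{c,i})·v_i)` with `v_i` in cert-2 g36's per-coordinate HULL of the windowed Lemma F
  bound (`wboxHullN` = g36's `wboxSummaryN` returning the hull vector instead of the slack; soundness re-derived from g36's
  `cutAcc_sound` along g36's own proof, `winForm_le_hull`, `phi30_le_hull`).
The supremum over the box of the resulting affine form with interval slopes is `E₀ + Σ_i r_i·max|slope_i|` — exact
integer arithmetic (`oneFormCheck`; none Prop-valued); **`gamma_le_of_oneFormCheck`** is the theorem.
-/

open Finset Set MeasureTheory
open Literature.Analysis.ValidatedNumerics.NumericsMP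

namespace Summit.KontsevichZagierPeriods.Zeta5Search.Barrier.ConeGamma

namespace OneForm

open LemmaFBox (SC KT lnNat SC_pos coef featVal minNum maxNum sum8 box centre centre_mem abs_sub_centre_le abs_le_of_mem
  getD_map_range featVal_sub_eq_sum sum8_eq_sum aOfS_normalise box_hyp)
open LemmaFWin (winForm winFormL winFormL_eq_winForm zI mem_zI winEnc winEnc_sound cutsOK sortedLE_spec mems_spec)
open LemmaFWinBox

/-! ### The `δ₂₈` minorant: a mixture of five-set sums -/

/-- Coordinate-wise sum of two coefficient lists (length 8). -/
def addVec (u v : List ℤ) : List ℤ := (List.range 8).map fun i => coef u i + coef v i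

/-- Entries of `addVec`. -/
theorem coef_addVec (u v : List ℤ) (i : Fin 8) : coef (addVec u v) i = coef u i + coef v i := by
  unfold addVec coef
  rw [getD_map_range _ _ i.isLt]

/-- `featVal` is additive under `addVec`. -/
theorem featVal_addVec (u v : List ℤ) (t : Fin 8 → ℝ) : featVal (addVec u v) t = featVal u t + featVal v t := by
  simp only [featVal, ← Finset.sum_add_distrib]
  refine Finset.sum_congr rfl fun i _ => ?_
  rw [coef_addVec]; push_cast; ring

/-- The zero coefficient list. -/
def zeroVec : List ℤ := [0, 0, 0, 0, 0, 0, 0, 0]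

/-- `featVal zeroVec = 0`. -/
theorem featVal_zeroVec (t : Fin 8 → ℝ) : featVal zeroVec t = 0 := by
  simp [featVal, zeroVec, coef, Fin.sum_univ_eight]

/-- The coefficient list of `Σ_{k∈S} h_k` for a list `S` of indices of the 28 forms. -/
def setVec : List (Fin 28) → List ℤ
  | [] => zeroVec
  | k :: ks => addVec (wallVec k) (setVec ks)

/-- The coefficient list of `Σ_j Σ_{k∈S_j} h_k` for a list of index lists. -/
def mixVec : List (List (Fin 28)) → List ℤ
  | [] => zeroVec
  | S :: Ss => addVec (setVec S) (mixVec Ss)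

/-- A five-element index set given as a duplicate-free list of length 5. -/
def dsetOK (S : List (Fin 28)) : Bool := decide (S.Nodup ∧ S.length = 5)

/-- `featVal (setVec S) t = Σ_{k∈S} h_k(aOfS t)` (as a list sum). -/
theorem featVal_setVec (t : Fin 8 → ℝ) : ∀ S : List (Fin 28),
    featVal (setVec S) t = (S.map fun k => h28 (aOfS t) k).sum
  | [] => by simp [setVec, featVal_zeroVec]
  | k :: ks => by
    rw [setVec, featVal_addVec, featVal_setVec t ks, List.map_cons, List.sum_cons, h28_aOfS_eq_featVal]

/-- One five-set: `Σ_{k∈S} h_k(aOfS t) ≤ δ₂₈(aOfS t)` (`le_delta28`). -/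
theorem featVal_setVec_le {S : List (Fin 28)} (hS : dsetOK S = true) (t : Fin 8 → ℝ) :
    featVal (setVec S) t ≤ delta28 (aOfS t) := by
  simp only [dsetOK, decide_eq_true_eq] at hS
  obtain ⟨hnd, hlen⟩ := hS
  rw [featVal_setVec]
  have hcard : S.toFinset.card = 5 := by rw [List.toFinset_card_of_nodup hnd, hlen]
  have e : (S.map fun k => h28 (aOfS t) k).sum = ∑ k ∈ S.toFinset, h28 (aOfS t) k := by
    rw [List.sum_toFinset _ hnd]
  rw [e]
  exact le_delta28 _ hcard

/-- **The mixture minorant**: `featVal (mixVec Ss) t ≤ W·δ₂₈(aOfS t)`, `W` the number of sets. -/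
theorem featVal_mixVec_le (t : Fin 8 → ℝ) : ∀ {Ss : List (List (Fin 28))}, (∀ S ∈ Ss, dsetOK S = true) →
    featVal (mixVec Ss) t ≤ (Ss.length : ℝ) * delta28 (aOfS t)
  | [], _ => by simp [mixVec, featVal_zeroVec]
  | S :: Ss, h => by
    rw [mixVec, featVal_addVec, List.length_cons]
    have h1 := featVal_setVec_le (h S (by simp)) t
    have h2 := featVal_mixVec_le t (Ss := Ss) (fun S' hS' => h S' (by simp [hS']))
    push_cast
    linarith

/-- **`δ₂₈ ≥` the average of the five-set sums** (the convex PL `δ₂₈` lies above every convex combination of its pieces). -/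
theorem delta28_ge_mixture {Ss : List (List (Fin 28))} (hok : ∀ S ∈ Ss, dsetOK S = true) (hW : 0 < Ss.length)
    (t : Fin 8 → ℝ) : featVal (mixVec Ss) t / Ss.length ≤ delta28 (aOfS t) := by
  have hW' : (0 : ℝ) < Ss.length := by exact_mod_cast hW
  rw [div_le_iff₀ hW', mul_comm]
  exact featVal_mixVec_le t hok

/-! ### cert-2 g36's windowed-Lemma-F hull, with the hull vector exposed -/

/-- g36's `wboxSummaryN` returning the per-coordinate HULL `g` (8 intervals at scale `SC`) instead of the slack:
the centre enclosure `I` of `winForm` and `g` with «∀ t ∈ box ∃ v, v_i ∈ g_i ∧ B(t) − B(t_c) = Σ (t_i − t_{c,i}) v_i»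
for the feature part `B` of the cut form. -/
def wboxHullN (lo hi : List ℕ) (D E : ℕ) (cuts : List ℕ) (mems : List (Fin 7 × Fin 7)) : Option (MI × List MI) :=
  match winEnc (centrePt lo hi) (2 * D) E cuts mems, lnNat D, tabListN lo hi mems with
  | some I, some LD, some Ts =>
    match cutAcc D E LD lo hi cuts Ts none zeroHull with
    | none => none
    | some g => some (I, g)
  | _, _, _ => none

/-- **The hull form of the windowed bound on the box** (g36's `winForm_le_of_wboxCheck`, stopped before the slack is
taken): `winForm(t) ≤ I.hi/SC + Σ_i (t_i − t_{c,i})·v_i` with `v_i ∈ g_i` for every `t` of the box. -/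
theorem winForm_le_hull {lo hi : List ℕ} {D E : ℕ} {cuts : List ℕ} {mems : List (Fin 7 × Fin 7)}
    (hbox : boxOK8 D lo hi = true) (hcuts : cutsOK E cuts mems = true) {I : MI} {g : List MI}
    (hh : wboxHullN lo hi D E cuts mems = some (I, g)) {t : Fin 8 → ℝ} (ht : t ∈ box D lo hi) :
    ∃ v : Fin 8 → ℝ, (∀ i : Fin 8, MI.mem SC (v i) (getI g i)) ∧
      winForm t (cuts.length - 1) (fun w => ((cuts.getD w 0 : ℕ) : ℝ) / E)
          (fun w => (mems.getD w (0, 1)).1) (fun w => (mems.getD w (0, 1)).2)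
        ≤ (I.hi : ℝ) / SC + ∑ i : Fin 8, (t i - centre D lo hi i) * v i := by
  obtain ⟨hD, hlo0, hhi0, hle⟩ := boxOK8_spec hbox
  have hle' : ∀ i : Fin 8, lo.getD i 0 ≤ hi.getD i 0 := fun i => (hle i).1
  have hcuts' := hcuts
  simp only [cutsOK, Bool.and_eq_true, decide_eq_true_eq] at hcuts'
  obtain ⟨⟨⟨⟨⟨hE, hA0⟩, hsort⟩, hlen⟩, hlenpos⟩, hmems⟩ := hcuts'
  unfold wboxHullN at hh
  split at hh
  case h_2 => simp at hh
  rename_i I' LD Ts hI hLD hTs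
  split at hh
  · simp at hh
  rename_i g' hg
  simp only [Option.some.injEq, Prod.mk.injEq] at hh
  obtain ⟨rfl, rfl⟩ := hh
  have hS : (0 : ℝ) < SC := by exact_mod_cast SC_pos
  -- positivity of the cuts
  have hApos : ∀ A ∈ cuts, 0 < A := by
    intro A hA
    obtain ⟨n, hn, e⟩ := List.getElem_of_mem hA
    have hmono : ∀ m, m < cuts.length → cuts.getD 0 0 ≤ cuts.getD m 0 := by
      intro m hm
      induction m with
      | zero => exact le_rfl
      | succ m ih => exact (ih (by omega)).trans (sortedLE_spec cuts hsort m hm)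
    have := hmono n hn
    rw [List.getD_eq_getElem _ _ hn, e] at this
    omega
  -- the centre
  set c := centre D lo hi with hcdef
  have hcmem : c ∈ box D lo hi := centre_mem hD hle'
  have hct : ∀ i : Fin 8, c i * ((2 * D : ℕ) : ℝ) = (((centrePt lo hi).getD i 0 : ℕ) : ℝ) := centre_mul D hD lo hi
  obtain ⟨_, hcI⟩ := winEnc_sound hI hct
  -- the cut form at `t` and at `c`
  have hcl : cuts.length = (cuts.length - 1) + 1 := by omega
  have hml : mems.length = (cuts.length - 1) + 1 := by omega
  have et := winFormL_eq_winForm t E (cuts.length - 1) cuts mems hcl hml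
  have ec := winFormL_eq_winForm c E (cuts.length - 1) cuts mems hcl hml
  rw [← et]; rw [← ec] at hcI
  rw [winFormL_eq_cutForm hD hE ht cuts mems hTs hlen hApos]
  rw [winFormL_eq_cutForm hD hE hcmem cuts mems hTs hlen hApos] at hcI
  -- the hull
  have hinv := cutAcc_sound hD hE (MI.mem_logNat2 SC_pos hLD) hle' cuts Ts none (S := fun _ => 0)
    (hull_zero D lo hi) hApos (tabListN_nonneg mems hTs) (fun P hP => by simp at hP) hg t ht
  obtain ⟨v, hv, hdiff⟩ := hinv
  simp only [featRestP, zero_add, sub_zero] at hdiff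
  refine ⟨v, hv, ?_⟩
  have hcentre : memConst E cuts (cntList lo hi mems) + featRest E cuts Ts c ≤ (I'.hi : ℝ) / SC := by
    rw [le_div_iff₀ hS]; exact hcI.2
  have e2 : featRest E cuts Ts t = featRest E cuts Ts c + ∑ i : Fin 8, (t i - c i) * v i := by linarith
  rw [e2]
  linarith

/-- **The hull form for `Φ`**: with the first-wall condition on the box, for every direction `a` of the closed box
whose normalised parameters `t = s(a)/s₀(a)` lie in the box,
`Φ(a) ≤ s₀(a)·(I.hi/SC + Σ_i (t_i − t_{c,i})·v_i)` for some `v` in the hull (g36's `phi30_le_of_wboxCheck`, hull form). -/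
theorem phi30_le_hull {lo hi : List ℕ} {D E : ℕ} {cuts : List ℕ} {mems : List (Fin 7 × Fin 7)}
    (hbox : boxOK8 D lo hi = true) (hcuts : cutsOK E cuts mems = true)
    (hwall : wallOKBox lo hi E (cuts.getD 0 0) D = true) {I : MI} {g : List MI}
    (hh : wboxHullN lo hi D E cuts mems = some (I, g)) {a : Dir} (ha : BZBox a)
    (ht : ∀ i : Fin 8, ((lo.getD i 0 : ℕ) : ℝ) ≤ sParam a i / sParam a 0 * D ∧
      sParam a i / sParam a 0 * D ≤ ((hi.getD i 0 : ℕ) : ℝ)) :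
    ∃ v : Fin 8 → ℝ, (∀ i : Fin 8, MI.mem SC (v i) (getI g i)) ∧
      phi30 a ≤ sParam a 0 * ((I.hi : ℝ) / SC
        + ∑ i : Fin 8, (sParam a i / sParam a 0 - centre D lo hi i) * v i) := by
  obtain ⟨v, hv, hwin⟩ := winForm_le_hull hbox hcuts hh (t := fun i => sParam a i / sParam a 0) ht
  refine ⟨v, hv, ?_⟩
  obtain ⟨hD, hlo0, hhi0, hle⟩ := boxOK8_spec hbox
  have hcuts' := hcuts
  simp only [cutsOK, Bool.and_eq_true, decide_eq_true_eq] at hcuts'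
  obtain ⟨⟨⟨⟨⟨hE, hA0⟩, hsort⟩, hlen⟩, _⟩, hmems⟩ := hcuts'
  have hD' : (0 : ℝ) < D := by exact_mod_cast hD
  have hE' : (0 : ℝ) < E := by exact_mod_cast hE
  set s : Fin 8 → ℝ := fun i => sParam a i / sParam a 0 with hs
  have hs0 : s 0 = 1 := by simp [hs, div_self ha.1.ne']
  have hslo : ∀ j : Fin 7, 0 ≤ s j.succ := fun j => by
    have h1 := (ht j.succ).1
    have h0 : (0 : ℝ) ≤ ((lo.getD j.succ 0 : ℕ) : ℝ) := Nat.cast_nonneg _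
    exact nonneg_of_mul_nonneg_left (h0.trans h1) hD'
  have hshi : ∀ j : Fin 7, s j.succ ≤ s 0 := fun j => by
    have h1 := (ht j.succ).2
    have h2 : ((hi.getD j.succ 0 : ℕ) : ℝ) ≤ (D : ℝ) := by exact_mod_cast (hle j.succ).2
    rw [hs0]
    have : s j.succ * D ≤ 1 * D := by rw [one_mul]; exact h1.trans h2
    exact le_of_mul_le_mul_right this hD'
  have hU0 : (0 : ℝ) < ((cuts.getD 0 0 : ℕ) : ℝ) / E := by
    have : (0 : ℝ) < ((cuts.getD 0 0 : ℕ) : ℝ) := by exact_mod_cast hA0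
    positivity
  have hU : ∀ w < cuts.length - 1, ((cuts.getD w 0 : ℕ) : ℝ) / E ≤ ((cuts.getD (w + 1) 0 : ℕ) : ℝ) / E :=
    fun w hw => div_le_div_of_nonneg_right (by exact_mod_cast sortedLE_spec cuts hsort w (by omega)) hE'.le
  have hpq : ∀ w ≤ cuts.length - 1, (mems.getD w (0, 1)).1 ≠ (mems.getD w (0, 1)).2 :=
    fun w hw => mems_spec hmems (by omega)
  have hP2 := LemmaFWin.phi30_aOfS_le_winForm s (by rw [hs0]; exact one_pos) hslo hshi (cuts.length - 1)
    (fun w => ((cuts.getD w 0 : ℕ) : ℝ) / E) hU0 (hh_of_wallOKBox hwall hD hE ht) hU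
    (fun w => (mems.getD w (0, 1)).1) (fun w => (mems.getD w (0, 1)).2) hpq
  have e : phi30 a = sParam a 0 * phi30 (aOfS s) := by
    conv_lhs => rw [aOfS_normalise ha]
    rw [phi30_smul ha.1]
  rw [e]
  exact mul_le_mul_of_nonneg_left (hP2.trans hwin) ha.1.le

/-! ### The one-form checker -/

/-- Scaled centre value `Σ_i coef_i·(lo_i + hi_i)` of a linear form (`= 2D·featVal c t_c`). -/
def cenNum (c : List ℤ) (lo hi : List ℕ) : ℤ :=
  sum8 fun i => coef c i * (((lo.getD i 0 : ℕ) : ℤ) + ((hi.getD i 0 : ℕ) : ℤ))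

/-- Per-coordinate slope magnitude bound at scale `SC·W`: `max |g_i.lo·W − d_i·SC| |g_i.hi·W − d_i·SC|`
(`g` the Φ-hull, `d` the δ-mixture coefficients, `W` the number of mixed sets). -/
def slopeMag (g : List MI) (d : List ℤ) (W : ℕ) (i : ℕ) : ℤ :=
  max |(getI g i).lo * (W : ℤ) - coef d i * (SC : ℤ)| |(getI g i).hi * (W : ℤ) - coef d i * (SC : ℤ)|

/-- The scaled slack `Σ_i (hi_i − lo_i)·slopeMag_i` (scale `2D·SC·W`). -/
def slackNum (g : List MI) (d : List ℤ) (W : ℕ) (lo hi : List ℕ) : ℤ :=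
  sum8 fun i => (((hi.getD i 0 : ℕ) : ℤ) - ((lo.getD i 0 : ℕ) : ℤ)) * slopeMag g d W i

/-- **The two integer coefficients of the one-form**: with `W` mixed sets, `d` their coefficient list and `(I, g)` the
Φ centre enclosure / hull, the box inequality `(1 − γ*)c₁⁺ − c₀⁻ − γ*·(mixture) + γ*·(Φ-hull form) ≤ 0` multiplied by
`den·W·SC·2D·gden` reads `gden·A + gnum·B ≤ 0` with
`A = (c1hi − c0lo)·W·SC·2D`, `B = −c1hi·W·SC·2D − cenNum(d)·den·SC + I.hi·den·W·2D + slackNum·den`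
(so the least certifiable `γ* = gnum/gden` is `⌈−gden·A/B⌉/gden` when `B < 0`). -/
def oneFormAB (lo hi : List ℕ) (D E : ℕ) (cuts : List ℕ) (mems : List (Fin 7 × Fin 7))
    (Ss : List (List (Fin 28))) (c1hi c0lo : ℤ) (den : ℕ) : Option (ℤ × ℤ) :=
  match wboxHullN lo hi D E cuts mems with
  | some (I, g) =>
    some ((c1hi - c0lo) * (Ss.length : ℤ) * (SC : ℤ) * (2 * D),
      -c1hi * (Ss.length : ℤ) * (SC : ℤ) * (2 * D) - cenNum (mixVec Ss) lo hi * den * (SC : ℤ)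
        + I.hi * den * (Ss.length : ℤ) * (2 * D) + slackNum g (mixVec Ss) Ss.length lo hi * den)
  | none => none

/-- **THE ONE-FORM BOX CHECK.** Data: the box `(D, lo, hi)`, g36's Φ-data `(E, cuts, mems)`, the δ-mixture `Ss` (lists of
five indices of the 28 forms), the C-side constants `c₁⁺ = c1hi/den`, `c₀⁻ = c0lo/den`, and `γ* = gnum/gden ∈ [0, 1]`.
It decides `gden·A + gnum·B ≤ 0` (`oneFormAB`) in exact integers. -/
def oneFormCheck (lo hi : List ℕ) (D E : ℕ) (cuts : List ℕ) (mems : List (Fin 7 × Fin 7))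
    (Ss : List (List (Fin 28))) (c1hi c0lo : ℤ) (den gnum gden : ℕ) : Bool :=
  boxOK8 D lo hi && cutsOK E cuts mems && wallOKBox lo hi E (cuts.getD 0 0) D && decide (0 < den) &&
    decide (0 < gden) && decide (gnum ≤ gden) && decide (0 < Ss.length) && (Ss.all fun S => dsetOK S) &&
    match oneFormAB lo hi D E cuts mems Ss c1hi c0lo den with
    | some (A, B) => decide ((gden : ℤ) * A + (gnum : ℤ) * B ≤ 0)
    | none => false

end OneForm

end Summit.KontsevichZagierPeriods.Zeta5Search.Barrier.ConeGamma
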